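import Literature.MathematicalPhysics.QuantumFieldTheory.Balaban1983to89.B11Thm1ExistsUniqueTokensGB

/-!
# `Balaban1983to89.B11Thm1ExistsUniqueRealisedDataB` — [Balaban1985Variational] = «[15]», (7) p. 278, (11)–(14) pp. 279–280:
# THE REGULAR-REALISED DATA PREDICATE `DataRegularRealisedTop av Ω Ω₀ k δ W` (a `TopData`: `dataRegularRealisedTopOf F N`) — the class of multi-scale data
# `W = M˙(U*)` on which print's (11) «V₀ = V on ⋃_{j<k} Λ_j, V̄₀ = V on Λ_k» and (14) at `k = 1` «we take simply U₀ = V₀» are IDENTITIES (V₀ := W, U₀ := W 0)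

Honest framing: statement-level skeleton of published theorems with citation tags; proofs where landed; nothing here is a claim about the Yang–Mills mass gap.  Cell `pub-ymgap`
(HUMAN RULINGS D-0062 ∕ D-0149), lane `pub-ymgap-dag-n12-c` g38 (R134 seat (a), N12 = [B15], s1; the CONSUMER lane of the (E∕U) fact); `--kind definition --supports` K1⁹
`stmt-QuantumFields-27364`; count-neutral; N12 NOT discharged; finite 𝕋⁴ at fixed ε; nothing continuum ∕ ℝ⁴ ∕ OS ∕ mass-gap ∕ Clay.  A named `Prop` WITH PARAMETERS, NEVER
ASSERTED (no `sorry`, no `axiom`, no `instance`, no `notation`); THIS FILE IS STATEMENT-ONLY (two definitions + `Iff.rfl`); the proved bridges (both readings of (7), heredity under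
print's truncation, the LIFT ∕ SUPPLY-at-length-1 token BODIES, the induction) live in the sibling THEOREMS-ONLY module `B11Thm1ExistsUniqueRealisedDataBBridges`.

WHY (the lane's s1 reading of print's producer shape for the orphan (E∕U) edge N07 → N12).  Print proves Theorem 1 by induction on the length ONLY to manufacture an approximate
minimiser `U₀` with (14) (`B11Thm1ExistsUniqueTokensGB`: NAME ⇐ STEP ∧ (R) ∧ SUPPLY-at-1 ∧ LIFT, `…TokensGBBridges.variationalThm1EUSep…7MGB_of_step_of_reg_of_base_of_lift`).  The two
bookkeeping tokens are print's (11) p. 279 — *«We can easily construct a configuration V₀ on 𝔅′_{k−1} such that it satisfies (7) on 𝔅′_{k−1}, and V₀ = V on ⋃_{j<k} Λ_j, V̄₀ = V on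
Λ_k. For example we can take V₀,b = V_{b′} for b ∈ B(b′), b′ ∈ Λ_k and V₀,b = 1 for remaining bonds of B(Λ_k)»* — and p. 280 — *«for k = 1 we do not have any solutions of the
variational problem yet, and then we take simply U₀ = V₀»*.  LOCATED (this lane, 2026-08-30): for a GENERAL datum `V` with (7) the example filling does NOT satisfy (7) on `𝔅′_{k−1}` — a
`(k−1)`-plaquette of `Λ′_{k−1} = Λ_{k−1} ∪ B(Λ_k)` straddling the interface between the filling and the pinned finer datum has `(∂V₀)(p′) = V₀(crossing)·V_{k−1}(tangent)·V₀(crossing)⁻¹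
·V₀(tangent)⁻¹`, a RAW bond variable of `V_{k−1}` which (7) does not control; meeting (7) there while keeping `V̄₀ = V` on `Λ_k` and `V₀ = V` bondwise on `Λ_{k−1}` is a small-curvature
lattice gauge-field EXTENSION problem with a geometric constant, not an identity.  For REALISED data — `V = M˙(U*)`, every level the block average of the previous one, `V_{j+1} = M(V_j)`
— (11) holds with `V₀ := V` (then `V̄₀ = M(V_{k−1}) = V_k`) and (14) at `k = 1` with `U₀ := V₀ = V 0`, by BOOKKEEPING, provided the datum is plaquette-small on the FULL level-`j` ranges
(print's (7) below the top excludes the plaquettes with a corner in `Ω_{j+1}^{(j)}`, [Balaban1984PropagatorsII] (2.3); the truncated problem's (7) asks them at its new top) and the fine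
member is plaquette-small on the plaquettes meeting `Ω₁` at the scale-`1` threshold (the (1.7) ∕ (1.9) rows of (14) at `k = 1`, the co-divergence through its stencil).  N12's junction
datum IS of this kind: `W := M˙(Q_k^{s*}Ṽ_k) = avgFamily (avOfRecord F 2 Kt) (qsstarGIter0 (k i) (ext i Vk))` ([Balaban1989LargeFieldI] (1.74), [Balaban1988Convergent] (2.16)), every
level plaquette-small inside `Z` (`B15Prop1DatumSmall7AtZSequence.plaqSmallOn_qsstarGIter[0]_of_isBlockUnion`; sibling `B11Thm1ExistsUniqueRealisedDataQsstar`).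

THE PREDICATE (§1, generic lattice `P`, gauge group `G`, averaging family `av`): `DataRegularRealisedTop av Ω Ω₀ k δ W :=`
 (R)  `∀ n < k, W (n+1) = (av n).avg (W n)` — REALISED below the top ([Balaban1988Convergent] (2.11) `M˙(U) = (Mʲ(U))_j`; print's «V̄₀ = V»);
 (F₀) `PlaqSmallOn (plaqsOf Ω₀) (δ 0) (W 0)` — the fine member on every plaquette meeting the top domain ([15] (2),(7) at `j = 0` on `Ω₀`, [6] (1.7));
 (F₁) `PlaqSmallOn (plaqsOf (Ω 1)) (δ 1) (W 0)` — the fine member on every plaquette meeting `Ω₁`, at the scale-`1` threshold (what «U₀ = V₀» needs at `k = 1`);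
 (Fₙ) `∀ 1 ≤ n ≤ k, PlaqSmallOn (plaqsOf (pts n (Ω n))) (δ n) (W n)` — the level-`n` member on EVERY level-`n` plaquette meeting `Ω_n^{(n)}` (print's (7) range `Sect2.lamPlaqs Ω k n` plus
      the plaquettes with a corner in `Ω_{n+1}^{(n)}` — the truncated problem's top range).
For realised data both typed readings of (7) FOLLOW ((b): `Sect2.DataSmall7PTop`; print (α): `Sect2.DataSmall7LamTop` — the (7) field spliced with `V̄ = M(W_m)` IS `W_{m+1}`), the
predicate is HEREDITARY under print's truncation `truncSeq` with the SAME thresholds, and the LIFT ∕ SUPPLY-at-1 token bodies over `(lamDatum F, dataRegularRealisedTopOf F N)` hold by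
bookkeeping (sibling `…Bridges`).  Thresholds `δ n` raw per level (the record's convention: `Sect2.DataSmall7PTop`, `…LamTop`).
-- TODO(general form): print's (11)–(14) for an ARBITRARY datum with (7) (the extension lemma above) and for general admissible `𝔅_k` of [6] Sect. A; here realised data over a (2.18) index.

CONTENTS (every `def` a `Prop` with parameters, NEVER asserted; every theorem `Iff.rfl`).
* §1 ★ `DataRegularRealisedTop av Ω Ω₀ k δ W` (generic) · `dataRegularRealisedTop_iff` (`Iff.rfl`).
* §2 ★ `dataRegularRealisedTopOf F N : Node00.TopData F N` — the record instance `av := Node00.avOfRecord F N K` (same arity ∕ order as `Node00.dataSmall7PTopOf` ∕ `dataSmall7LamTopOf`),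
  `dataRegularRealisedTopOf_apply` (`Iff.rfl`).
NOT HERE (sibling `…Bridges`, THEOREMS ONLY): accessors, `.toPTop ∕ .toLamTop`, `.truncSeq`, the stencil lemma, LIFT ∕ SUPPLY bodies, (E∕U)ᴮ ⇐ STEPᴮ ∧ (R)ᴮ at realised data.

HONEST SCOPE.  Two definitions + `Iff.rfl`; nothing of [15]'s analysis asserted or proved; no token inhabited here; `stub_prop8StepCoPGridG13` ∕ K0⁷ NOT closed; K1⁹ OPEN; N12 NOT
discharged; counts unmoved (discharged 8∕27); one finite 𝕋⁴ programme at fixed ε — the route closes the conditional finite-𝕋⁴ rung `BalabanLadder.UV` only; nothing continuum ∕ ℝ⁴ ∕ OS;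
the Yang–Mills mass gap (Clay) is NOT proved by any of this.

References: [15] = [Balaban1985Variational] (2)–(7) p.278, Thm 1 (8) p.279, (11) p.279, (12)–(14) p.280; [6] = [Balaban1985RegularSpaces] (1.3)–(1.9) p.77; [II] =
[Balaban1984PropagatorsII] (2.3) p.224; [III] = [Balaban1988Convergent] (2.2) p.255, (2.10)–(2.12) p.256, (2.16) p.257; [IV] = [Balaban1989LargeFieldI] (1.74) p.192, p.193 L14–20.
-/

noncomputable section

namespace Literature.MathematicalPhysics.QuantumFieldTheory.Balaban1983to89.B11Thm1ExistsUniqueRealisedDataB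

open T4Continuum B15DeterminingSets B15DeterminingSetsB GaugeField Node00
open B8Eq17ClassAkV1 (plaqsOf)

/-! ## §1  The regular-realised data predicate (generic lattice, gauge group, averaging family) -/

section Generic

variable {P : Params} {G : Type*} [GaugeGroup G]

/-- **★ REGULAR-REALISED MULTI-SCALE DATA** for a sequence `Ω` with `k` levels, a top domain `Ω₀` and thresholds `δ` (a `Prop` with parameters, NEVER asserted): (R) the datum is REALISED
below the top — `W (n+1) = M(W n)` for `n < k` ([III] (2.11) `M˙(U) = (Mʲ(U))_j`; print's (11) «V̄₀ = V on Λ_k» becomes an identity with `V₀ := W`); (F₀) the fine member `W 0` is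
`δ₀`-small on every plaquette meeting the top domain `Ω₀` ([15] (2),(7) at scale 0; [6] (1.7)); (F₁) `W 0` is `δ₁`-small on every plaquette meeting `Ω₁` (what (14) at `k = 1` with
«U₀ = V₀» reads); (Fₙ) for `1 ≤ n ≤ k` the level-`n` member `W n` is `δ_n`-small on EVERY level-`n` plaquette meeting `Ω_n^{(n)}` (print's (7) range PLUS the plaquettes with a corner in
`Ω_{n+1}^{(n)}`, which (7) on the truncated problem `𝔅′` asks at its top).  For such data print's (11)–(13) and (14) at length 1 are bookkeeping (sibling `…Bridges`); N12's junction datum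
`M˙(Q_k^{s*}Ṽ_k)` is of this kind (sibling `…Qsstar`).
-- TODO(general form): [15] (11)–(14) for an arbitrary datum with (7) — a small-curvature lattice gauge-field extension across `∂B(Λ_k)` with a geometric constant (print's example
-- filling «V₀,b = V_{b′} …, = 1» leaves the interface plaquettes uncontrolled); general admissible `𝔅_k` of [6] Sect. A; one threshold `ε₁`.
[cite: Balaban1985Variational, (7) p.278 L20–33, (11) p.279, (12)–(14) p.280; Balaban1988Convergent, (2.11) p.256, (2.16) p.257; Balaban1985RegularSpaces, (1.7) p.77; Balaban1984PropagatorsII, (2.3) p.224] -/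
def DataRegularRealisedTop (av : ∀ j, Averaging P j G) (Ω : ℕ → Set (Site P 0)) (Ω₀ : Set (Site P 0)) (k : ℕ) (δ : ℕ → ℝ) (W : MSField P G) : Prop :=
  (∀ n, n < k → W (n + 1) = (av n).avg (W n)) ∧
    PlaqSmallOn (plaqsOf Ω₀) (δ 0) (W 0) ∧
      PlaqSmallOn (plaqsOf (Ω 1)) (δ 1) (W 0) ∧
        ∀ n, 1 ≤ n → n ≤ k → PlaqSmallOn (plaqsOf (pts n (Ω n))) (δ n) (W n)

/-- Unfolding of `DataRegularRealisedTop` (definitional). [cite: Balaban1985Variational, (7) p.278, (11) p.279 (bookkeeping)] -/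
theorem dataRegularRealisedTop_iff (av : ∀ j, Averaging P j G) (Ω : ℕ → Set (Site P 0)) (Ω₀ : Set (Site P 0)) (k : ℕ) (δ : ℕ → ℝ) (W : MSField P G) :
    DataRegularRealisedTop av Ω Ω₀ k δ W ↔
      (∀ n, n < k → W (n + 1) = (av n).avg (W n)) ∧
        PlaqSmallOn (plaqsOf Ω₀) (δ 0) (W 0) ∧
          PlaqSmallOn (plaqsOf (Ω 1)) (δ 1) (W 0) ∧
            ∀ n, 1 ≤ n → n ≤ k → PlaqSmallOn (plaqsOf (pts n (Ω n))) (δ n) (W n) :=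
  Iff.rfl

end Generic

/-! ## §2  The record instance, as a `TopData` -/

section Record

variable (F : T4Family) (N : ℕ) [NeZero N]

/-- **★ REGULAR-REALISED DATA AT THE RECORD, AS A `TopData`** — `DataRegularRealisedTop (Node00.avOfRecord F N K) Ω Ω₀ k δ W` in the arity ∕ order of `Node00.dataSmall7PTopOf` ∕
`Node00.dataSmall7LamTopOf` (F0c's `Dat` binder of the [15] tokens ᴮ): the data predicate at which the LIFT ∕ SUPPLY-at-1 tokens over print's datum `Node00.lamDatum F` hold by
bookkeeping, so that the (E∕U) name there follows from the ONE-LENGTH STEP token and K0's (R)-name alone (sibling `…Bridges`).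
[cite: Balaban1985Variational, (7) p.278, (11) p.279, (14) p.280; Balaban1988Convergent, (2.11) p.256; Balaban1984PropagatorsII, (2.3) p.224] -/
def dataRegularRealisedTopOf : TopData F N := fun K Ω Ω₀ k δ W => DataRegularRealisedTop (avOfRecord F N K) Ω Ω₀ k δ W

variable {F N}

/-- Unfolding of `dataRegularRealisedTopOf` (definitional). [cite: Balaban1985Variational, (7) p.278 (bookkeeping)] -/
theorem dataRegularRealisedTopOf_apply (K : ℕ) (Ω : ℕ → Set (Site (F.P K) 0)) (Ω₀ : Set (Site (F.P K) 0)) (k : ℕ) (δ : ℕ → ℝ) (W : MSField (F.P K) (SU N)) :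
    dataRegularRealisedTopOf F N K Ω Ω₀ k δ W ↔ DataRegularRealisedTop (avOfRecord F N K) Ω Ω₀ k δ W := Iff.rfl

end Record

end Literature.MathematicalPhysics.QuantumFieldTheory.Balaban1983to89.B11Thm1ExistsUniqueRealisedDataB

end
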